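import Literature.Analysis.FluidPDE.FluidComputer.HelicityBalance

/-!
# The vorticity form of the Galerkin system (what dns-B steps) is the velocity form (what dns-A steps)

dns-B integrates the truncated equations in VORTICITY form with Biot–Savart inversion
(HOME/code/dnsB/dnsb.py header): `dω̂/dt = i k × (u × ω)^_S(k) - ν|k|² ω̂(k)`, `û(k) = i k × ω̂(k)/|k|²`
(`k ≠ 0`, zero mean flow). dns-A integrates the velocity form `dû/dt = -ν|k|²û + P_k N_S(k)`
(rotational form after Leray projection, `RotationalForm`). This file records that, for fields supported
in a mask `S ∌ 0`, the two are the SAME system: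

* `kcross_kcross` — BAC–CAB on the lattice, `k × (k × a) = (k·a) k - |k|² a`;
* `biotSavart`, `biotSavart_curl`, `curl_biotSavart` — on each mode `k ≠ 0`, `û ↦ ω̂ = i k × û` and
  `ω̂ ↦ i k × ω̂/|k|²` are inverse to each other on divergence-free vectors;
* `hasDerivAt_vorticity_galerkin` — along every supported Galerkin solution (any pressure multiplier),
  the vorticity coefficients obey dns-B's equation `dω̂(k)/dt = -ν|k|²ω̂(k) + i k × ((u × ω)^_S(k) + f̂(k))`
  (the pressure drops out: `k × k = 0`; `k × N_S = k × (u × ω)^_S` is `kcross_rotational`);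
* `isGalerkinSolution_of_vorticity` — conversely, a supported family whose vorticity coefficients obey
  dns-B's equation on a mask `S ∌ 0` IS a Galerkin solution in velocity form, with the Leray pressure
  multiplier `c(k) = k·(N_S(k) + f̂(k))/|k|²`.

So every typed identity of this directory (energy/enstrophy/helicity budgets, transfers, the TG37
coefficients, the CL-abc curve, uniqueness) applies verbatim to the system dns-B integrates. [folklore:
equivalence of the velocity and vorticity formulations for periodic mean-zero fields; CanutoEtAl2007 §3.3
lists the equivalent forms of the nonlinear term] 0 sorry, 0 named facts. HONEST FRAMING: typed
infrastructure for a low prior, high value-of-information experiment on Tao's machine paradigm; NOT a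
claim that NS blows up.
-/

noncomputable section

namespace Literature.Analysis.FluidPDE.FluidComputer

open Complex ComplexConjugate Finset
open scoped BigOperators

namespace ShellTransfer

/-! ## Lattice vector algebra -/

/-- **BAC–CAB**: `(k × (k × a))_j = (k·a) k_j - |k|² a_j`. [folklore] -/
theorem kcross_kcross (k : Fin 3 → ℤ) (a : Fin 3 → ℂ) (j : Fin 3) :
    kcross k (kcross k a) j = kdot k a * ((k j : ℤ) : ℂ) - (knormSq k : ℂ) * a j := by
  unfold kdot knormSq
  push_cast
  fin_cases j <;> simp [kcross, Fin.sum_univ_three] <;> ring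

/-- `k × (c a) = c (k × a)`. [folklore] -/
theorem kcross_const_mul' (k : Fin 3 → ℤ) (c : ℂ) (a : Fin 3 → ℂ) :
    kcross k (fun j => c * a j) = fun j => c * kcross k a j := by
  funext j
  fin_cases j <;> simp [kcross] <;> ring

/-- `k × (a - b) = k × a - k × b`. [folklore] -/
theorem kcross_sub (k : Fin 3 → ℤ) (a b : Fin 3 → ℂ) :
    kcross k (fun j => a j - b j) = fun j => kcross k a j - kcross k b j := by
  funext j
  fin_cases j <;> simp [kcross] <;> ring

/-- **Biot–Savart on the lattice**: `BS_k(w) = i k × w / |k|²` (the velocity whose vorticity coefficient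
at `k` is `w`). [folklore] -/
def biotSavart (k : Fin 3 → ℤ) (w : Fin 3 → ℂ) : Fin 3 → ℂ :=
  fun j => I * kcross k w j / (knormSq k : ℂ)

/-- **`BS_k(ω̂(k)) = û(k)`** for `k ≠ 0` (divergence-free `û`): Biot–Savart inverts the curl mode by mode.
[folklore] -/
theorem biotSavart_curl (U : FourierVelocity) {k : Fin 3 → ℤ} (hk : knormSq k ≠ 0) :
    biotSavart k ((curl U).coeff k) = U.coeff k := by
  funext j
  unfold biotSavart
  have hkC : (knormSq k : ℂ) ≠ 0 := by exact_mod_cast hk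
  have e : (curl U).coeff k = fun i => I * kcross k (U.coeff k) i := funext fun i => curl_coeff U k i
  rw [e, kcross_const_mul']
  beta_reduce
  rw [kcross_kcross]
  have hdiv : kdot k (U.coeff k) = 0 := U.divFree k
  rw [hdiv, zero_mul, zero_sub]
  have h1 : I * (I * -((knormSq k : ℂ) * U.coeff k j)) / (knormSq k : ℂ) = -(I * I) * U.coeff k j := by
    field_simp
  rw [h1, Complex.I_mul_I]
  ring

/-- **`i k × BS_k(w) = w`** for `k ≠ 0` and `k · w = 0`: the curl inverts Biot–Savart. [folklore] -/
theorem curl_biotSavart {k : Fin 3 → ℤ} (hk : knormSq k ≠ 0) {w : Fin 3 → ℂ} (hw : kdot k w = 0)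
    (j : Fin 3) : I * kcross k (biotSavart k w) j = w j := by
  unfold biotSavart
  have hkC : (knormSq k : ℂ) ≠ 0 := by exact_mod_cast hk
  have e : (fun j => I * kcross k w j / (knormSq k : ℂ)) = fun j => (I / (knormSq k : ℂ)) * kcross k w j := by
    funext i; ring
  rw [e, kcross_const_mul']
  beta_reduce
  rw [kcross_kcross, hw, zero_mul, zero_sub]
  have h1 : I * (I / (knormSq k : ℂ) * -((knormSq k : ℂ) * w j)) = -(I * I) * w j := by
    field_simp
  rw [h1, Complex.I_mul_I]
  ring

/-! ## Velocity form ⇒ vorticity form -/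

/-- `k ×` applied to the Galerkin right-hand side: the pressure term drops out.
[folklore] -/
theorem kcross_galerkinRHS (U : FourierVelocity) (S : Finset (Fin 3 → ℤ)) (ν : ℝ) (c : (Fin 3 → ℤ) → ℂ)
    (f : (Fin 3 → ℤ) → Fin 3 → ℂ) (k : Fin 3 → ℤ) (j : Fin 3) :
    kcross k (fun i => galerkinRHS U S ν c f k i) j =
      -(ν : ℂ) * (knormSq k : ℂ) * kcross k (U.coeff k) j +
        kcross k (fun i => advection U S k i + f k i) j := by
  unfold galerkinRHS
  fin_cases j <;> simp [kcross] <;> ring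

/-- **THE VORTICITY EQUATION OF THE GALERKIN SYSTEM** (dns-B's equation): along every Galerkin solution
(any pressure multiplier `c`), for `k ∈ S`,
`dω̂_j(k)/dt = -ν|k|² ω̂_j(k) + i (k × (N_S(k) + f̂(k)))_j`. [folklore] -/
theorem hasDerivAt_curl_galerkin {U : ℝ → FourierVelocity} {S : Finset (Fin 3 → ℤ)} {ν : ℝ}
    {c : ℝ → (Fin 3 → ℤ) → ℂ} {f : ℝ → (Fin 3 → ℤ) → Fin 3 → ℂ} (hU : IsGalerkinSolution U S ν c f)
    (t : ℝ) {k : Fin 3 → ℤ} (hk : k ∈ S) (j : Fin 3) :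
    HasDerivAt (fun s => (curl (U s)).coeff k j)
      (-(ν : ℂ) * (knormSq k : ℂ) * (curl (U t)).coeff k j +
        I * kcross k (fun i => advection (U t) S k i + f t k i) j) t := by
  have h := (hasDerivAt_kcross (U := U) (k := k) (fun i => hU t k hk i) j).const_mul I
  have e : (fun s => (curl (U s)).coeff k j) = fun s => I * kcross k ((U s).coeff k) j :=
    funext fun s => curl_coeff (U s) k j
  rw [e]
  refine h.congr_deriv ?_
  rw [kcross_galerkinRHS, curl_coeff]
  ring

/-- The same with the nonlinearity in dns-B's ROTATIONAL form `i k × (u × ω)^_S(k)` (for fields supported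
in `S`; `kcross_rotational`). [folklore] -/
theorem hasDerivAt_vorticity_galerkin {U : ℝ → FourierVelocity} {S : Finset (Fin 3 → ℤ)} {ν : ℝ}
    {c : ℝ → (Fin 3 → ℤ) → ℂ} {f : ℝ → (Fin 3 → ℤ) → Fin 3 → ℂ} (hU : IsGalerkinSolution U S ν c f)
    (hsupp : IsSupportedOn U S) (t : ℝ) {k : Fin 3 → ℤ} (hk : k ∈ S) (j : Fin 3) :
    HasDerivAt (fun s => (curl (U s)).coeff k j)
      (-(ν : ℂ) * (knormSq k : ℂ) * (curl (U t)).coeff k j +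
        I * kcross k (fun i => rotational (U t) S k i + f t k i) j) t := by
  have h := hasDerivAt_curl_galerkin hU t hk j
  refine h.congr_deriv ?_
  congr 2
  rw [kcross_add, kcross_add]
  simp only
  rw [kcross_rotational (U t) S (hsupp t) k]

/-! ## Vorticity form ⇒ velocity form -/

/-- **A SOLUTION OF dns-B's EQUATION IS A GALERKIN SOLUTION.** Let `U` be supported in a mask `S ∌ 0` and
suppose its vorticity coefficients obey `dω̂_j(k)/dt = -ν|k|²ω̂_j(k) + i(k × ((u × ω)^_S(k) + f̂(k)))_j`
for `k ∈ S`. Then `U` solves the velocity-form Galerkin system with the Leray pressure multiplier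
`c(k) = k·(N_S(k) + f̂(k))/|k|²`. [folklore] -/
theorem isGalerkinSolution_of_vorticity {U : ℝ → FourierVelocity} {S : Finset (Fin 3 → ℤ)} {ν : ℝ}
    {f : ℝ → (Fin 3 → ℤ) → Fin 3 → ℂ} (h0 : (0 : Fin 3 → ℤ) ∉ S) (hsupp : IsSupportedOn U S)
    (hW : ∀ t : ℝ, ∀ k ∈ S, ∀ j : Fin 3,
      HasDerivAt (fun s => (curl (U s)).coeff k j)
        (-(ν : ℂ) * (knormSq k : ℂ) * (curl (U t)).coeff k j +
          I * kcross k (fun i => rotational (U t) S k i + f t k i) j) t) :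
    IsGalerkinSolution U S ν
      (fun t k => kdot k (fun i => advection (U t) S k i + f t k i) / (knormSq k : ℂ)) f := by
  intro t k hk j
  have hkn : knormSq k ≠ 0 := fun h => h0 (((knormSq_eq_zero_iff k).mp h) ▸ hk)
  have hkC : (knormSq k : ℂ) ≠ 0 := by exact_mod_cast hkn
  -- û = Biot–Savart of ω̂, coefficient by coefficient and at all times
  have e : (fun s => (U s).coeff k j) = fun s => I * kcross k ((curl (U s)).coeff k) j / (knormSq k : ℂ) := by
    funext s
    have hb := congrFun (biotSavart_curl (U s) hkn) j
    unfold biotSavart at hb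
    exact hb.symm
  rw [e]
  -- differentiate through `k ×`
  have hkc := hasDerivAt_kcross (U := fun s => curl (U s)) (k := k) (fun i => hW t k hk i) j
  have h := (hkc.const_mul I).div_const (knormSq k : ℂ)
  refine h.congr_deriv ?_
  -- algebra: I (k × (-ν|k|² ω̂ + I k × M)) / |k|² = -ν|k|² û + M - (k·M/|k|²) k
  set M : Fin 3 → ℂ := fun i => rotational (U t) S k i + f t k i with hM
  have eW : (fun i => -(ν : ℂ) * (knormSq k : ℂ) * (curl (U t)).coeff k i + I * kcross k M i) =
      fun i => (-(ν : ℂ) * (knormSq k : ℂ) * I) * kcross k (U t |>.coeff k) i + I * kcross k M i := by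
    funext i; rw [curl_coeff]; ring
  rw [eW]
  have split : kcross k (fun i => (-(ν : ℂ) * (knormSq k : ℂ) * I) * kcross k ((U t).coeff k) i + I * kcross k M i) j
      = (-(ν : ℂ) * (knormSq k : ℂ) * I) * kcross k (kcross k ((U t).coeff k)) j + I * kcross k (kcross k M) j := by
    have := congrFun (kcross_add k (fun i => (-(ν : ℂ) * (knormSq k : ℂ) * I) * kcross k ((U t).coeff k) i)
      (fun i => I * kcross k M i)) j
    rw [this, kcross_const_mul', kcross_const_mul']
  have hdiv : kdot k ((U t).coeff k) = 0 := (U t).divFree k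
  rw [split, kcross_kcross, kcross_kcross, hdiv]
  -- the rotational form and the advection form have the same Leray projection / same k·(·) up to the gradient part
  have hrot : ∀ i, M i = (advection (U t) S k i + f t k i) + gradPart (U t) S k * ((k i : ℤ) : ℂ) := by
    intro i
    simp only [hM, rotational_eq (U t) S (hsupp t) k i]
    ring
  have hMdot : kdot k M = kdot k (fun i => advection (U t) S k i + f t k i) + gradPart (U t) S k * (knormSq k : ℂ) := by
    unfold kdot
    simp_rw [hrot]
    rw [← sum_intCast_mul_self, Finset.mul_sum, ← Finset.sum_add_distrib]
    refine Finset.sum_congr rfl fun i _ => ?_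
    ring
  unfold galerkinRHS
  beta_reduce
  rw [hMdot, hrot j]
  -- eliminate `I² = -1`, then clear the denominator
  have h1 : I * (-(ν : ℂ) * (knormSq k : ℂ) * I * (0 * ((k j : ℤ) : ℂ) - (knormSq k : ℂ) * (U t).coeff k j) +
      I * ((kdot k (fun i => advection (U t) S k i + f t k i) + gradPart (U t) S k * (knormSq k : ℂ)) * ((k j : ℤ) : ℂ) -
        (knormSq k : ℂ) * (advection (U t) S k j + f t k j + gradPart (U t) S k * ((k j : ℤ) : ℂ)))) =
      (I * I) * ((ν : ℂ) * (knormSq k : ℂ) * (knormSq k : ℂ) * (U t).coeff k j +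
        ((kdot k (fun i => advection (U t) S k i + f t k i) + gradPart (U t) S k * (knormSq k : ℂ)) * ((k j : ℤ) : ℂ) -
          (knormSq k : ℂ) * (advection (U t) S k j + f t k j + gradPart (U t) S k * ((k j : ℤ) : ℂ)))) := by
    ring
  rw [h1, Complex.I_mul_I]
  field_simp
  ring

end ShellTransfer

end Literature.Analysis.FluidPDE.FluidComputer

end
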